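import Summits.Ventures.Crystal3D.Theorems.StickyWulffConstantNoReconstructionGainZonedFilm
import Summits.Ventures.Crystal3D.Theorems.StickyWulffConstantCoaxialWallLawFrame
import HarnessLib

/-!
# The atom at every normal for films inside the lattice plus ONE Shockley coset

HONEST FRAMING. Part of the venture `Summits/Ventures/Crystal3D` (cell `crystal3d-full`), helper
`--supports` the crux `NoReconstructionGain` (stmt-Ventures-19144, route
`route-Ventures-StickyWulffConstant`), line `adhesion`.  First HYPOTHESIS-FREE-PER-BALL instance of
the zoned composition rung (`zoned_cross_le`, `…ZonedFilm`): R26's registry lemma L1 (films of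
lattice sites, every `ν`) extended by one Shockley coset.  `Λ₀ = fccStacking 1 √(2/3)` (layers along
`e₃`, in-plane letter offset `w = barlowOffset 1`, `|w| = 1/√3`); `Λ₀ + w` is the coset of
hcp-hollow (twin) positions of the basal family.

* `fcc_coset_unit_height` — a UNIT vector of the coset `Λ₀ + w` has third coordinate EXACTLY
  `+√(2/3)`: a coset ball touches lattice balls only in the basal layer directly BELOW it (the
  Diophantine equation `(3I+K+1)² + (3I+K+1)(3J+K+1) + (3J+K+1)² + 6K² = 9` forces `K = 1`).
  Hence the zone rule of `zonedFilm_adhesion` holds automatically: lattice balls are antipodal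
  (zone 0), coset balls form a stratum along `e₃` sitting steeply on the lattice and on the
  substrate, coset–coset contacts are lattice vectors (flat or steep).
* `cosetFilm_adhesion` (**the rung**, every `ν`, `R = 1`, `C = 0`; registered by name): for every
  unit `ν`, `ρ ≥ 1`, and every finite unit packing `X ⊇ P` around the `ν`-slab sample `P` whose film
  balls all lie in `Λ₀ ∪ (Λ₀ + w)` — registry continuation, steps, islands, vacancies, overhangs,
  PLUS hcp-hollow adlayers / islands on any exposed basal micro-facet and a single intrinsic stacking
  fault of the basal family REACHING THE INTERFACE, in any combination and at any substrate
  orientation — `#cross(P, X \ P) ≤ contactDeficiency (X \ P)`.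
* `cosetFilm_adhesion'` — the same for `Λ₀ ∪ (Λ₀ − w)` (axis `−e₃`).

Census behind it (wulff-p1 g8, evidence RUNGS-g8.md §4): 93/93 intrinsic-fault films at eight
substrate normals satisfy the zone rule with zero violations; this file is the proof that they
must.  Three cosets at once (`Λ₀ ∪ (Λ₀+w) ∪ (Λ₀−w)`, i.e. general Barlow stacking along `e₃` at an
inclined `ν`) are NOT covered: the coset order is cyclic.

WHAT THIS IS NOT: other `{111}` families (follow by `adhesion_transport_of_invariant`, not done
here); twins (rotated lattices); rung F-C1 not moved.
-/

noncomputable section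

namespace Summit.Ventures.Crystal3D.Theorems

open Summit.Ventures.Crystal3D Finset
open Literature.MathematicalPhysics.StatisticalMechanics (barlowPos barlowStacking fccStacking
  barlowOffset constHagg haggLabel_const barlowPos_apply_zero barlowPos_apply_one barlowPos_apply_two
  orderedContacts contactDeficiency)
open scoped InnerProductSpace

/-! ### The coset contact lemma -/

/-- **A unit vector of the coset `Λ₀ + w` points one layer UP.**  If `v − w ∈ Λ₀`
(`w = barlowOffset 1`) and `‖v‖ = 1` then `v₂ = √(2/3)`. -/
theorem fcc_coset_unit_height (v : EuclideanSpace ℝ (Fin 3))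
    (hv : v - barlowOffset 1 ∈ fccStacking 1 (Real.sqrt (2 / 3))) (h1 : ‖v‖ = 1) :
    v 2 = Real.sqrt (2 / 3) := by
  obtain ⟨K, I, J, hK⟩ := hv
  have hv' : v = barlowPos 1 (Real.sqrt (2 / 3)) constHagg K I J + barlowOffset 1 := by
    rw [← hK]; abel
  have h3 : Real.sqrt 3 ^ 2 = 3 := Real.sq_sqrt (by norm_num)
  have hh : Real.sqrt (2 / 3) ^ 2 = 2 / 3 := Real.sq_sqrt (by norm_num)
  have hv0 : v 0 = (I : ℝ) + J / 2 + K / 2 + 1 / 2 := by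
    rw [hv', PiLp.add_apply, barlowPos_apply_zero, haggLabel_const]
    simp [barlowOffset]
  have hv1 : v 1 = Real.sqrt 3 / 2 * ((J : ℝ) + K / 3) + Real.sqrt 3 / 6 := by
    rw [hv', PiLp.add_apply, barlowPos_apply_one, haggLabel_const]
    simp [barlowOffset]
  have hv2 : v 2 = (K : ℝ) * Real.sqrt (2 / 3) := by
    rw [hv', PiLp.add_apply, barlowPos_apply_two]
    simp [barlowOffset]
  have hnorm : ‖v‖ ^ 2 = v 0 ^ 2 + v 1 ^ 2 + v 2 ^ 2 := by
    rw [EuclideanSpace.real_norm_sq_eq, Fin.sum_univ_three]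
  rw [h1, one_pow, hv0, hv1, hv2] at hnorm
  -- the integer equation `(3I+K+1)² + (3I+K+1)(3J+K+1) + (3J+K+1)² + 6K² = 9`
  have hR : ((3 * I + K + 1) ^ 2 + (3 * I + K + 1) * (3 * J + K + 1) + (3 * J + K + 1) ^ 2 +
      6 * K ^ 2 : ℝ) = 9 := by
    have e : (Real.sqrt 3 / 2 * ((J : ℝ) + K / 3) + Real.sqrt 3 / 6) ^ 2 =
        3 * ((3 * J + K + 1) / 6) ^ 2 := by
      have : Real.sqrt 3 / 2 * ((J : ℝ) + K / 3) + Real.sqrt 3 / 6 =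
          Real.sqrt 3 * ((3 * J + K + 1) / 6) := by ring
      rw [this, mul_pow, h3]
    have e2 : ((K : ℝ) * Real.sqrt (2 / 3)) ^ 2 = 2 / 3 * K ^ 2 := by rw [mul_pow, hh]; ring
    rw [e, e2] at hnorm
    nlinarith [hnorm]
  have hZ : (3 * I + K + 1) ^ 2 + (3 * I + K + 1) * (3 * J + K + 1) + (3 * J + K + 1) ^ 2 +
      6 * K ^ 2 = 9 := by exact_mod_cast hR
  -- bound and decide: `K = 1`
  generalize hA : 3 * I + K + 1 = A at hZ
  generalize hB : 3 * J + K + 1 = B at hZ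
  have hK2 : K ^ 2 ≤ 1 := by nlinarith [sq_nonneg (2 * A + B), sq_nonneg B]
  have hB2 : B ^ 2 ≤ 12 := by nlinarith [sq_nonneg (2 * A + B), sq_nonneg K]
  have hA2 : A ^ 2 ≤ 12 := by nlinarith [sq_nonneg (2 * B + A), sq_nonneg K]
  have hKb : -1 ≤ K ∧ K ≤ 1 := by constructor <;> nlinarith
  have hBb : -3 ≤ B ∧ B ≤ 3 := by constructor <;> nlinarith
  have hAb : -3 ≤ A ∧ A ≤ 3 := by constructor <;> nlinarith
  have hIb : -1 ≤ I ∧ I ≤ 1 := by omega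
  have hJb : -1 ≤ J ∧ J ≤ 1 := by omega
  have key : ∀ K₁ ∈ Finset.Icc (-1 : ℤ) 1, ∀ I₁ ∈ Finset.Icc (-1 : ℤ) 1, ∀ J₁ ∈ Finset.Icc (-1 : ℤ) 1,
      (3 * I₁ + K₁ + 1) ^ 2 + (3 * I₁ + K₁ + 1) * (3 * J₁ + K₁ + 1) + (3 * J₁ + K₁ + 1) ^ 2 +
        6 * K₁ ^ 2 = 9 → K₁ = 1 := by
    decide
  have hK1 : K = 1 := key K (Finset.mem_Icc.2 hKb) I (Finset.mem_Icc.2 hIb) J (Finset.mem_Icc.2 hJb)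
    (by rw [hA, hB]; exact hZ)
  rw [hv2, hK1]; simp

/-- A lattice ball touching a ball of the coset `Λ₀ + w` lies exactly one layer below it. -/
theorem fcc_coset_partner_below {y q : EuclideanSpace ℝ (Fin 3)}
    (hy : y ∈ fccStacking 1 (Real.sqrt (2 / 3)))
    (hq : q - barlowOffset 1 ∈ fccStacking 1 (Real.sqrt (2 / 3))) (hd : dist q y = 1) :
    y 2 - q 2 = -Real.sqrt (2 / 3) := by
  have h := fcc_coset_unit_height (q - y) (by
    have : q - y - barlowOffset 1 = (q - barlowOffset 1) - y := by abel
    rw [this]; exact fcc_sub_site_mem hq hy) (by rw [← dist_eq_norm]; exact hd)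
  rw [PiLp.sub_apply] at h
  linarith

/-- A lattice ball touching a ball of the coset `Λ₀ − w` lies exactly one layer above it. -/
theorem fcc_negCoset_partner_above {y q : EuclideanSpace ℝ (Fin 3)}
    (hy : y ∈ fccStacking 1 (Real.sqrt (2 / 3)))
    (hq : q + barlowOffset 1 ∈ fccStacking 1 (Real.sqrt (2 / 3))) (hd : dist q y = 1) :
    y 2 - q 2 = Real.sqrt (2 / 3) := by
  have h := fcc_coset_unit_height (y - q) (by
    have : y - q - barlowOffset 1 = y - (q + barlowOffset 1) := by abel
    rw [this]; exact fcc_sub_site_mem hy hq) (by rw [← dist_eq_norm, dist_comm]; exact hd)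
  rw [PiLp.sub_apply] at h
  exact h

/-- Two balls of the same coset differ by a lattice unit vector: the height difference is `0` or
`±√(2/3)`. -/
theorem fcc_sameCoset_height {x q t : EuclideanSpace ℝ (Fin 3)}
    (hx : x - t ∈ fccStacking 1 (Real.sqrt (2 / 3))) (hq : q - t ∈ fccStacking 1 (Real.sqrt (2 / 3)))
    (hd : dist q x = 1) :
    x 2 - q 2 = 0 ∨ Real.sqrt (2 / 3) ≤ x 2 - q 2 ∨ x 2 - q 2 ≤ -Real.sqrt (2 / 3) := by
  have hd' : dist (q - t) (x - t) = 1 := by rw [dist_sub_right]; exact hd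
  obtain ⟨c, hc, h⟩ := fcc_unit_directions (q - t) (x - t) hq hx hd'
  have hpos : 0 < Real.sqrt (2 / 3) := Real.sqrt_pos.2 (by norm_num)
  have hx2 : x 2 - q 2 = (barlowPos 1 (Real.sqrt (2 / 3)) constHagg c.1 c.2.1 c.2.2) 2 ∨
      x 2 - q 2 = -(barlowPos 1 (Real.sqrt (2 / 3)) constHagg c.1 c.2.1 c.2.2) 2 := by
    rcases h with h | h
    · left
      have := congrArg (fun z : EuclideanSpace ℝ (Fin 3) => z 2) h
      simp only [PiLp.sub_apply, PiLp.add_apply] at this; linarith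
    · right
      have := congrArg (fun z : EuclideanSpace ℝ (Fin 3) => z 2) h
      simp only [PiLp.sub_apply] at this; linarith
  rw [barlowPos_apply_two] at hx2
  -- `c.1 ∈ {0, 1, -1}` by the explicit list
  simp only [List.mem_cons, List.mem_nil_iff, or_false] at hc
  rcases hc with rfl | rfl | rfl | rfl | rfl | rfl <;> simp only at hx2 <;>
    rcases hx2 with h2 | h2 <;> rw [h2] <;> simp

/-! ### The rungs -/

/-- The third basis vector as the stratum axis. -/
private theorem inner_unitAxisTwo (v : EuclideanSpace ℝ (Fin 3)) :
    ⟪v, EuclideanSpace.single (2 : Fin 3) (1 : ℝ)⟫_ℝ = v 2 := by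
  simp [EuclideanSpace.inner_single_right]

/-- The third basis vector is a unit vector. -/
private theorem norm_unitAxisTwo : ‖(EuclideanSpace.single (2 : Fin 3) (1 : ℝ))‖ = 1 := by
  simp

/-- Common core of the two coset rungs: `t = ±w` with the corresponding height law for lattice
partners of coset balls. -/
theorem cosetFilm_cross_le (ν : EuclideanSpace ℝ (Fin 3)) (hν : ‖ν‖ = 1) (ρ : ℝ) (hρ : 1 ≤ ρ)
    (X P : Finset (EuclideanSpace ℝ (Fin 3)))
    (hX : ∀ p ∈ X, ∀ q ∈ X, p ≠ q → 1 ≤ dist p q) (hPX : P ⊆ X)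
    (hP : ∀ p, p ∈ P ↔ (p ∈ fccStacking 1 (Real.sqrt (2 / 3)) ∧ -(2 * (1 : ℝ)) ≤ ⟪p, ν⟫_ℝ ∧
      ⟪p, ν⟫_ℝ ≤ -1 ∧ ‖p‖ ^ 2 - ⟪p, ν⟫_ℝ ^ 2 ≤ ρ ^ 2))
    (t axis : EuclideanSpace ℝ (Fin 3)) (haxis : ‖axis‖ = 1)
    (hfilm : ∀ q ∈ X \ P, q ∈ fccStacking 1 (Real.sqrt (2 / 3)) ∨
      q - t ∈ fccStacking 1 (Real.sqrt (2 / 3)))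
    (hlaw : ∀ y q : EuclideanSpace ℝ (Fin 3), y ∈ fccStacking 1 (Real.sqrt (2 / 3)) →
      q - t ∈ fccStacking 1 (Real.sqrt (2 / 3)) → dist q y = 1 → ⟪y - q, axis⟫_ℝ ≤ -Real.sqrt (2 / 3))
    (hsame : ∀ x q : EuclideanSpace ℝ (Fin 3), x - t ∈ fccStacking 1 (Real.sqrt (2 / 3)) →
      q - t ∈ fccStacking 1 (Real.sqrt (2 / 3)) → dist q x = 1 →
      ⟪x - q, axis⟫_ℝ = 0 ∨ Real.sqrt (2 / 3) ≤ ⟪x - q, axis⟫_ℝ ∨ ⟪x - q, axis⟫_ℝ ≤ -Real.sqrt (2 / 3)) :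
    ((((P ×ˢ (X \ P)).filter fun pq => dist pq.1 pq.2 = 1).card : ℕ) : ℝ) ≤
      contactDeficiency (X \ P) := by
  classical
  set Λ := fccStacking 1 (Real.sqrt (2 / 3)) with hΛ
  set Z : EuclideanSpace ℝ (Fin 3) → ℕ := fun q => if q ∈ Λ then 0 else 1 with hZ
  set g : EuclideanSpace ℝ (Fin 3) → ℝ := fun y =>
    max (ρ ^ 2 * (2 * ⟪y, ν⟫_ℝ + 3 * 1) ^ 2) (1 ^ 2 * (‖y‖ ^ 2 - ⟪y, ν⟫_ℝ ^ 2)) with hg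
  have hconv : ∀ y w : EuclideanSpace ℝ (Fin 3), 2 * g y ≤ g (y + w) + g (y - w) := fun y w => by
    simp only [hg]; exact slabGauge_midpoint ν hν 1 ρ y w
  -- the six bond vectors
  set S6 : List (ℤ × ℤ × ℤ) := [((0 : ℤ), (1 : ℤ), (0 : ℤ)), (0, 0, 1), (1, 0, 0), (0, 1, -1),
    (-1, 1, 0), (-1, 0, 1)] with hS6
  set W : Finset (EuclideanSpace ℝ (Fin 3)) :=
    (S6.map fun c => barlowPos 1 (Real.sqrt (2 / 3)) constHagg c.1 c.2.1 c.2.2).toFinset with hW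
  have hWcard : W.card ≤ 6 := by
    rw [hW]; refine (List.toFinset_card_le _).trans ?_; simp [hS6]
  have hPΛ : ∀ p ∈ P, p ∈ Λ := fun p hp => ((hP p).1 hp).1
  have hZ0 : ∀ q, Z q = 0 ↔ q ∈ Λ := fun q => by
    simp only [hZ]; split_ifs with h <;> simp [h]
  have h := zoned_cross_le X P hX hPX Z (fun _ => axis) (fun _ => haxis) ∅ (empty_subset _) g hconv
    (fun q hq hZq => ?_) (fun q hq hZq y hy hd => ?_)
  · simpa using h
  · -- zone 0: a lattice ball — antipodal lines, substrate gauge-below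
    rw [sdiff_empty] at hq
    have hqΛ : q ∈ Λ := (hZ0 q).1 hZq
    refine Or.inr ⟨⟨W, hWcard, fun x hx hdx => ?_⟩, fun p hp hd => ?_⟩
    · by_cases hxΛ : x ∈ Λ
      · obtain ⟨c, hc, hcx⟩ := fcc_unit_directions q x hqΛ hxΛ hdx
        refine Or.inr ⟨barlowPos 1 (Real.sqrt (2 / 3)) constHagg c.1 c.2.1 c.2.2, ?_, hcx⟩
        rw [hW, List.mem_toFinset, List.mem_map]
        exact ⟨c, hc, rfl⟩
      · refine Or.inl ⟨mem_sdiff.2 ⟨hx, fun hxP => hxΛ (hPΛ x hxP)⟩, ?_⟩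
        have : Z x ≠ 0 := fun h0 => hxΛ ((hZ0 x).1 h0)
        omega
    · obtain ⟨_, hp1, hp2, hp3⟩ := (hP p).1 hp
      have hqK : ¬(-(2 * (1 : ℝ)) ≤ ⟪q, ν⟫_ℝ ∧ ⟪q, ν⟫_ℝ ≤ -1 ∧ ‖q‖ ^ 2 - ⟪q, ν⟫_ℝ ^ 2 ≤ ρ ^ 2) :=
        fun hK => (mem_sdiff.1 hq).2 ((hP q).2 ⟨hqΛ, hK⟩)
      have hle : g p ≤ 1 ^ 2 * ρ ^ 2 := by
        simp only [hg]; exact slabGauge_le ν 1 ρ p hp1 hp2 hp3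
      have hlt : 1 ^ 2 * ρ ^ 2 < g q := by
        simp only [hg]; exact lt_slabGauge ν 1 ρ one_pos (by linarith) q hqK
      linarith
  · -- zone 1: a coset ball — everything it touches outside the coset is one layer below
    rw [sdiff_empty] at hq
    have hqΛ : q ∉ Λ := fun h' => hZq ((hZ0 q).2 h')
    have hqt : q - t ∈ Λ := (hfilm q hq).resolve_left hqΛ
    have hZq1 : Z q = 1 := by simp only [hZ, hqΛ, if_false]
    refine ⟨fun hyP => hlaw y q (hPΛ y hyP) hqt hd, fun hyQ hZy => ?_, fun hyQ hZy => ?_⟩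
    · have hy0 : Z y = 0 := by omega
      exact hlaw y q ((hZ0 y).1 hy0) hqt hd
    · have hyΛ : y ∉ Λ := fun h' => by rw [(hZ0 y).2 h', hZq1] at hZy; exact absurd hZy (by norm_num)
      exact hsame y q ((hfilm y hyQ).resolve_left hyΛ) hqt hd

/-- **The atom at every normal for films inside `Λ₀ ∪ (Λ₀ + w)`** (`R = 1`, `C = 0`; registered by
name on stmt-Ventures-19144): registry film plus one Shockley coset of the basal family (hcp-hollow
adlayers, islands, a single intrinsic fault reaching the interface), every substrate orientation. -/
theorem cosetFilm_adhesion :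
    ∃ R C : ℝ, 1 ≤ R ∧ ∀ ν : EuclideanSpace ℝ (Fin 3), ‖ν‖ = 1 → ∀ ρ : ℝ, R ≤ ρ →
      ∀ X P : Finset (EuclideanSpace ℝ (Fin 3)),
      (∀ p ∈ X, ∀ q ∈ X, p ≠ q → 1 ≤ dist p q) → P ⊆ X →
      (∀ p, p ∈ P ↔ (p ∈ fccStacking 1 (Real.sqrt (2 / 3)) ∧ -(2 * R) ≤ ⟪p, ν⟫_ℝ ∧
        ⟪p, ν⟫_ℝ ≤ -R ∧ ‖p‖ ^ 2 - ⟪p, ν⟫_ℝ ^ 2 ≤ ρ ^ 2)) →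
      (∀ q ∈ X \ P, q ∈ fccStacking 1 (Real.sqrt (2 / 3)) ∨
        q - barlowOffset 1 ∈ fccStacking 1 (Real.sqrt (2 / 3))) →
      ((((P ×ˢ (X \ P)).filter fun pq => dist pq.1 pq.2 = 1).card : ℕ) : ℝ) ≤
        contactDeficiency (X \ P) + C * ρ := by
  refine ⟨1, 0, le_rfl, fun ν hν ρ hρ X P hX hPX hP hfilm => ?_⟩
  rw [zero_mul, add_zero]
  refine cosetFilm_cross_le ν hν ρ hρ X P hX hPX hP (barlowOffset 1)
    (EuclideanSpace.single (2 : Fin 3) (1 : ℝ)) norm_unitAxisTwo hfilm (fun y q hy hq hd => ?_)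
    (fun x q hx hq hd => ?_)
  · rw [inner_unitAxisTwo, PiLp.sub_apply, fcc_coset_partner_below hy hq hd]
  · rw [inner_unitAxisTwo, PiLp.sub_apply]; exact fcc_sameCoset_height hx hq hd

/-- **The atom at every normal for films inside `Λ₀ ∪ (Λ₀ − w)`** (the opposite Shockley coset;
`R = 1`, `C = 0`; registered by name on stmt-Ventures-19144). -/
theorem cosetFilm_adhesion' :
    ∃ R C : ℝ, 1 ≤ R ∧ ∀ ν : EuclideanSpace ℝ (Fin 3), ‖ν‖ = 1 → ∀ ρ : ℝ, R ≤ ρ →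
      ∀ X P : Finset (EuclideanSpace ℝ (Fin 3)),
      (∀ p ∈ X, ∀ q ∈ X, p ≠ q → 1 ≤ dist p q) → P ⊆ X →
      (∀ p, p ∈ P ↔ (p ∈ fccStacking 1 (Real.sqrt (2 / 3)) ∧ -(2 * R) ≤ ⟪p, ν⟫_ℝ ∧
        ⟪p, ν⟫_ℝ ≤ -R ∧ ‖p‖ ^ 2 - ⟪p, ν⟫_ℝ ^ 2 ≤ ρ ^ 2)) →
      (∀ q ∈ X \ P, q ∈ fccStacking 1 (Real.sqrt (2 / 3)) ∨
        q + barlowOffset 1 ∈ fccStacking 1 (Real.sqrt (2 / 3))) →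
      ((((P ×ˢ (X \ P)).filter fun pq => dist pq.1 pq.2 = 1).card : ℕ) : ℝ) ≤
        contactDeficiency (X \ P) + C * ρ := by
  refine ⟨1, 0, le_rfl, fun ν hν ρ hρ X P hX hPX hP hfilm => ?_⟩
  rw [zero_mul, add_zero]
  have hfilm' : ∀ q ∈ X \ P, q ∈ fccStacking 1 (Real.sqrt (2 / 3)) ∨
      q - (-barlowOffset 1) ∈ fccStacking 1 (Real.sqrt (2 / 3)) := fun q hq => by
    rw [sub_neg_eq_add]; exact hfilm q hq
  refine cosetFilm_cross_le ν hν ρ hρ X P hX hPX hP (-barlowOffset 1)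
    (-EuclideanSpace.single (2 : Fin 3) (1 : ℝ)) (by rw [norm_neg, norm_unitAxisTwo]) hfilm'
    (fun y q hy hq hd => ?_) (fun x q hx hq hd => ?_)
  · rw [sub_neg_eq_add] at hq
    rw [inner_neg_right, inner_unitAxisTwo, PiLp.sub_apply, fcc_negCoset_partner_above hy hq hd]
  · rw [inner_neg_right, inner_unitAxisTwo, PiLp.sub_apply]
    have hpos : 0 < Real.sqrt (2 / 3) := Real.sqrt_pos.2 (by norm_num)
    rcases fcc_sameCoset_height hx hq hd with h | h | h
    · left; linarith
    · right; right; linarith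
    · right; left; linarith

end Summit.Ventures.Crystal3D.Theorems

end
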